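import Summits.Schanuel.Schanuel.Theorems.RootDecomp1HHull
import Summits.Schanuel.Schanuel.Theorems.RootDecomp1JPairSplit

/-!
# RootDecomp1H ∩ RootDecomp1J — CONVERGENCE THEOREM «the tower hull is the curve hull», part 1: TOWERS

Lens-5 NODE «Hull» second edition §12–§13 (critic: ACCEPTED 08:20:46Z as a CONVERGENCE THEOREM, FOREST RULING R1; tree-ready port
`prover/RootDecomp1HCurveHull.port.lean` ACCEPTED 08:21:52Z), landed by the census seat (prover role) in THREE files at the 400-line cap:
this part 1 = the tower vocabulary over the LIVE route constants of RootDecomp1H (`TowerTuple`, `TowerSchanuel` — abbreviations of the inline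
texts of `RelTowerSchanuel` / `BridgeTransverse`), `towerSchanuel_iff_structural : TowerSchanuel ↔ ProductSchanuel ∧ RelTowerSchanuel`, the
tower toolkit (prefixes, `Fin.snoc`, rescaling, extension) and relative depth ≤ 1 in three kinds; part 2 = 1J's curve hull 𝓚 and the tower
hull 𝒯̂ with the MERGE LEMMA; part 3 = 𝓚 ≤ 𝒯̂, `towerHull_eq_curveHull`, `bridgeTransverse_iff_bridgeOffCurve`,
`schanuel_of_structural_of_pairSplit`.  0 sorry; standard axioms.
-/

set_option linter.dupNamespace false

noncomputable section

namespace Summit.Schanuel.Schanuel.Theorems.RootDecomp1HCurveHull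

open Complex Set
open Summit.Schanuel.Schanuel.Theses.RootDecomp1H (ProductSchanuel RelTowerSchanuel BridgeTransverse)
open Summit.Schanuel.Schanuel.Theses.RootDecomp1J (SchanuelOverCurveClosedFields PairBlocksOverCurveClosedFields
  SchanuelOverPairClosedFields SchanuelOverCurveClosedFieldsGlue)
open Summit.Schanuel.Schanuel.Theorems.RootDecomp1HTowerCells (trdeg_adjoin_adjoin_eq adjoin_le_of_mem_span_int
  trdeg_le_of_mem_span_int exists_scaled_family linearIndependent_scaled trdeg_le_of_depthOne trdeg_adjoin_union_le
  trdeg_adjoin_range_le)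
open Summit.Schanuel.Schanuel.Theorems.RootDecomp1HProductCells (eRk_le_of_span_eq le_trdeg_of_natCast_le_eRk)
open Summit.Schanuel.Schanuel.Theorems.RootDecomp1HHull (prefix_subset prefix_trdeg_le_of_eq hull_of_product_of_relTower)
open Summit.Schanuel.Schanuel.Theorems.RootDecomp1DFlagSplit (schanuelOn_of_relOn)
open Summit.Schanuel.Schanuel.Theorems.RootDecomp1JPairSplit (schanuelOverCurveClosedFieldsGlue_holds)
open Literature.NumberTheory.Transcendental (OneMotiveToric.trdeg_mono trdeg_adjoin_le_of_le exists_nsmul_mem_span_int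
  mem_adjoin_of_mem_span_int)

/-! ## 1. Towers (the inline text of `RelTowerSchanuel` / `BridgeTransverse`, abbreviated) -/

/-- `b` is a TOWER TUPLE: every prefix `b|k` has `trdeg ℚ(b|k, e^{b|k}) ≤ k` (verbatim the hypothesis of `RelTowerSchanuel`). -/
def TowerTuple {N : ℕ} (b : Fin N → ℂ) : Prop :=
  ∀ (k : ℕ) (hk : k ≤ N), Algebra.trdeg ℚ ↥(IntermediateField.adjoin ℚ (Set.range (b ∘ Fin.castLE hk) ∪
    Set.range (Complex.exp ∘ (b ∘ Fin.castLE hk)))) ≤ (k : Cardinal)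

/-- TOWER SCHANUEL: Schanuel at every `ℚ`-free tower tuple. -/
def TowerSchanuel : Prop :=
  ∀ (N : ℕ) (b : Fin N → ℂ), TowerTuple b → LinearIndependent ℚ b →
    (N : Cardinal) ≤ Algebra.trdeg ℚ ↥(IntermediateField.adjoin ℚ (Set.range b ∪ Set.range (Complex.exp ∘ b)))

/-- A tuple of depth-one numbers is a tower tuple. -/
theorem towerTuple_of_depthOne {n : ℕ} {u : Fin n → ℂ}
    (hu : ∀ j, Algebra.trdeg ℚ ↥(IntermediateField.adjoin ℚ ({u j, cexp (u j)} : Set ℂ)) ≤ 1) : TowerTuple u :=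
  fun _ hk => trdeg_le_of_depthOne (u ∘ Fin.castLE hk) fun _ => hu _

/-- `TowerSchanuel ⟸ ProductSchanuel ∧ RelTowerSchanuel` (the landed hull theorem at `y = b`). -/
theorem towerSchanuel_of_structural (hPS : ProductSchanuel) (hRT : RelTowerSchanuel) : TowerSchanuel :=
  fun N b htow hb => hull_of_product_of_relTower hPS hRT N b hb htow N b hb fun j => Submodule.subset_span ⟨j, rfl⟩

/-- `TowerSchanuel ⟹ ProductSchanuel` (a product tuple is a tower tuple) … -/
theorem productSchanuel_of_towerSchanuel (hTS : TowerSchanuel) : ProductSchanuel :=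
  fun n u hu hli => hTS n u (towerTuple_of_depthOne hu) hli

/-- … and `TowerSchanuel ⟹ RelTowerSchanuel` (drop the relativising hypothesis). -/
theorem relTowerSchanuel_of_towerSchanuel (hTS : TowerSchanuel) : RelTowerSchanuel :=
  fun n b htow hli _ => hTS n b htow hli

/-- Tower Schanuel ⟺ route 1H's structural side `ProductSchanuel ∧ RelTowerSchanuel`. -/
theorem towerSchanuel_iff_structural : TowerSchanuel ↔ (ProductSchanuel ∧ RelTowerSchanuel) :=
  ⟨fun h => ⟨productSchanuel_of_towerSchanuel h, relTowerSchanuel_of_towerSchanuel h⟩,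
    fun h => towerSchanuel_of_structural h.1 h.2⟩

/-! ### 1.1 Tower toolkit: prefixes, `Fin.snoc`, rescaling -/

/-- The initial segment of a tower tuple is a tower tuple. -/
theorem towerTuple_castSucc {N : ℕ} {b : Fin (N + 1) → ℂ} (hb : TowerTuple b) : TowerTuple (b ∘ Fin.castSucc) :=
  fun k hk => hb k (hk.trans (Nat.le_succ N))

/-- A tower tuple of length `N` generates a field of transcendence degree `≤ N` (Chow's remark). -/
theorem trdeg_le_of_towerTuple {N : ℕ} {b : Fin N → ℂ} (hb : TowerTuple b) :
    Algebra.trdeg ℚ ↥(IntermediateField.adjoin ℚ (range b ∪ range (cexp ∘ b))) ≤ (N : Cardinal) := by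
  have h := hb N le_rfl
  exact h

/-- The empty tuple is a tower tuple. -/
theorem towerTuple_elim0 : TowerTuple (Fin.elim0 : Fin 0 → ℂ) := by
  intro k hk
  obtain rfl : k = 0 := Nat.le_zero.mp hk
  exact trdeg_le_of_depthOne _ fun j => Fin.elim0 j

/-- Restricting along `Fin.castLE (le_refl _)` is the identity. -/
theorem comp_castLE_refl {N : ℕ} (b : Fin N → ℂ) (hk : N ≤ N) : b ∘ Fin.castLE hk = b :=
  funext fun _ => congrArg b (Fin.ext rfl)

/-- A proper prefix of `Fin.snoc u w` is a prefix of `u`. -/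
theorem snoc_comp_castLE {m : ℕ} (u : Fin m → ℂ) (w : ℂ) {k : ℕ} (hk : k ≤ m + 1) (hkm : k ≤ m) :
    (Fin.snoc u w : Fin (m + 1) → ℂ) ∘ Fin.castLE hk = u ∘ Fin.castLE hkm := by
  funext i
  have hi : (Fin.castLE hk i : Fin (m + 1)) = (Fin.castLE hkm i).castSucc := Fin.ext rfl
  simp only [Function.comp_apply, hi, Fin.snoc_castSucc]

/-- Generators of `u` = generators of its initial segment plus the last coordinate and its exponential. -/
theorem range_union_castSucc {n : ℕ} (u : Fin (n + 1) → ℂ) :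
    range u ∪ range (cexp ∘ u) ⊆
      (range (u ∘ Fin.castSucc) ∪ range (cexp ∘ (u ∘ Fin.castSucc))) ∪ {u (Fin.last n), cexp (u (Fin.last n))} := by
  rintro z (⟨i, rfl⟩ | ⟨i, rfl⟩)
  · rcases Fin.eq_castSucc_or_eq_last i with ⟨j, rfl⟩ | rfl
    · exact Or.inl (Or.inl ⟨j, rfl⟩)
    · exact Or.inr (Set.mem_insert _ _)
  · rcases Fin.eq_castSucc_or_eq_last i with ⟨j, rfl⟩ | rfl
    · exact Or.inl (Or.inr ⟨j, rfl⟩)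
    · exact Or.inr (Set.mem_insert_of_mem _ rfl)

/-- Generators of `Fin.snoc u w` = generators of `u` plus `w` and `e^w`. -/
theorem range_snoc_union {m : ℕ} (u : Fin m → ℂ) (w : ℂ) :
    range (Fin.snoc u w : Fin (m + 1) → ℂ) ∪ range (cexp ∘ (Fin.snoc u w : Fin (m + 1) → ℂ)) =
      (range u ∪ range (cexp ∘ u)) ∪ {w, cexp w} := by
  refine Set.Subset.antisymm ?_ ?_
  · refine (range_union_castSucc (Fin.snoc u w : Fin (m + 1) → ℂ)).trans (subset_of_eq ?_)
    rw [Fin.snoc_comp_castSucc, Fin.snoc_last]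
  · rintro z ((⟨i, rfl⟩ | ⟨i, rfl⟩) | rfl | rfl)
    · exact Or.inl ⟨i.castSucc, Fin.snoc_castSucc (α := fun _ => ℂ) w u i⟩
    · exact Or.inr ⟨i.castSucc, by simp only [Function.comp_apply, Fin.snoc_castSucc]⟩
    · exact Or.inl ⟨Fin.last m, Fin.snoc_last (α := fun _ => ℂ) z u⟩
    · exact Or.inr ⟨Fin.last m, by simp only [Function.comp_apply, Fin.snoc_last]⟩

/-- Each `u j` lies in the ℚ-span of `Fin.snoc u w`. -/
theorem snoc_mem_span {m : ℕ} (u : Fin m → ℂ) (w : ℂ) (j : Fin m) :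
    u j ∈ Submodule.span ℚ (range (Fin.snoc u w : Fin (m + 1) → ℂ)) :=
  Submodule.subset_span ⟨j.castSucc, Fin.snoc_castSucc (α := fun _ => ℂ) w u j⟩

/-- EXTENSION BY ONE STOREY: a tower `b` and `g` with `trdeg ℚ(b, e^b, g, e^g) ≤ N + 1` give the tower `(b, g)`. -/
theorem towerTuple_snoc {N : ℕ} {b : Fin N → ℂ} (htow : TowerTuple b) {g : ℂ}
    (hg : Algebra.trdeg ℚ ↥(IntermediateField.adjoin ℚ ((range b ∪ range (cexp ∘ b)) ∪ ({g, cexp g} : Set ℂ))) ≤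
      ((N + 1 : ℕ) : Cardinal)) :
    TowerTuple (Fin.snoc b g : Fin (N + 1) → ℂ) := by
  intro k hk
  by_cases hkN : k ≤ N
  · exact prefix_trdeg_le_of_eq (snoc_comp_castLE b g hk hkN) (htow k hkN)
  · obtain rfl : k = N + 1 := by omega
    refine prefix_trdeg_le_of_eq (comp_castLE_refl _ hk) ?_
    rw [range_snoc_union]
    exact hg

/-- … so `g` joins the hull of `b`: a free tower `c` with `span_ℚ b ≤ span_ℚ c ∋ g`. -/
theorem exists_tower_extension {N : ℕ} {b : Fin N → ℂ} (hb : LinearIndependent ℚ b) (htow : TowerTuple b) {g : ℂ}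
    (hg : Algebra.trdeg ℚ ↥(IntermediateField.adjoin ℚ ((range b ∪ range (cexp ∘ b)) ∪ ({g, cexp g} : Set ℂ))) ≤
      ((N + 1 : ℕ) : Cardinal)) :
    ∃ (L : ℕ) (c : Fin L → ℂ), LinearIndependent ℚ c ∧ TowerTuple c ∧
      Submodule.span ℚ (range b) ≤ Submodule.span ℚ (range c) ∧ g ∈ Submodule.span ℚ (range c) := by
  by_cases hmem : g ∈ Submodule.span ℚ (range b)
  · exact ⟨N, b, hb, htow, le_rfl, hmem⟩
  · exact ⟨N + 1, Fin.snoc b g, linearIndependent_finSnoc.2 ⟨hb, hmem⟩, towerTuple_snoc htow hg,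
      Submodule.span_le.2 (by rintro _ ⟨j, rfl⟩; exact snoc_mem_span b g j),
      Submodule.subset_span ⟨Fin.last N, Fin.snoc_last (α := fun _ => ℂ) g b⟩⟩

/-- Rescaling a family by non-zero rationals does not change its ℚ-span. -/
theorem span_range_smul_eq {ι : Type*} (u : ι → ℂ) (q : ι → ℚ) (hq : ∀ i, q i ≠ 0) :
    Submodule.span ℚ (range fun i => q i • u i) = Submodule.span ℚ (range u) := by
  apply le_antisymm
  · exact Submodule.span_le.2 (by
      rintro _ ⟨i, rfl⟩
      exact Submodule.smul_mem _ _ (Submodule.subset_span ⟨i, rfl⟩))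
  · refine Submodule.span_le.2 ?_
    rintro _ ⟨i, rfl⟩
    have h : u i = (q i)⁻¹ • (q i • u i) := by rw [smul_smul, inv_mul_cancel₀ (hq i), one_smul]
    rw [h]
    exact Submodule.smul_mem _ _ (Submodule.subset_span ⟨i, rfl⟩)

/-- Rescaling a ℚ-free family by non-zero rationals keeps it ℚ-free. -/
theorem linearIndependent_smul {ι : Type*} {u : ι → ℂ} (hu : LinearIndependent ℚ u) (q : ι → ℚ) (hq : ∀ i, q i ≠ 0) :
    LinearIndependent ℚ (fun i => q i • u i) := by
  let c : ι → ℚˣ := fun i => Units.mk0 (q i) (hq i)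
  have he : c • u = fun i => q i • u i := by
    funext i; simp only [Pi.smul_apply', c, Units.smul_def, Units.val_mk0]
  exact he ▸ hu.units_smul c

/-- A bound `trdeg ℚ(x, eˣ) ≤ c` transports along equal `ℚ`-spans (rank in the algebraic matroid, `RootDecomp1HProductCells`). -/
theorem trdeg_le_of_span_eq {k : ℕ} {x y : Fin k → ℂ} (h : Submodule.span ℚ (range x) = Submodule.span ℚ (range y)) {c : ℕ}
    (hx : Algebra.trdeg ℚ ↥(IntermediateField.adjoin ℚ (range x ∪ range (cexp ∘ x))) ≤ (c : Cardinal)) :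
    Algebra.trdeg ℚ ↥(IntermediateField.adjoin ℚ (range y ∪ range (cexp ∘ y))) ≤ (c : Cardinal) := by
  by_contra hlt
  rw [not_le] at hlt
  have h1 : ((c + 1 : ℕ) : Cardinal) ≤ Algebra.trdeg ℚ ↥(IntermediateField.adjoin ℚ (range y ∪ range (cexp ∘ y))) := by
    have h0 := Order.succ_le_of_lt hlt
    rw [Cardinal.succ_natCast] at h0
    exact_mod_cast h0
  have h2 := le_trdeg_of_natCast_le_eRk
    ((Literature.NumberTheory.Transcendental.ZilberHomogeneity.natCast_le_eRk_of_le_trdeg h1).trans (eRk_le_of_span_eq h))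
  have h3 := h2.trans hx
  norm_cast at h3
  omega

/-- RESCALING A TOWER coordinatewise by non-zero rationals gives a tower. -/
theorem towerTuple_smul {N : ℕ} {b : Fin N → ℂ} (htow : TowerTuple b) (q : Fin N → ℚ) (hq : ∀ i, q i ≠ 0) :
    TowerTuple (fun i => q i • b i) := by
  intro k hk
  have hss : Submodule.span ℚ (range (b ∘ Fin.castLE hk)) = Submodule.span ℚ (range ((fun i => q i • b i) ∘ Fin.castLE hk)) :=
    (span_range_smul_eq (b ∘ Fin.castLE hk) (q ∘ Fin.castLE hk) fun i => hq _).symm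
  exact trdeg_le_of_span_eq hss (htow k hk)

/-- Division by a positive integer inside a ℚ-span. -/
theorem mem_span_int_smul_inv {ι : Type*} (b : ι → ℂ) {x : ℂ} {M : ℕ} (hM : M ≠ 0)
    (hx : ((M : ℚ) • x) ∈ Submodule.span ℤ (range b)) :
    x ∈ Submodule.span ℤ (range (fun i => (M : ℚ)⁻¹ • b i)) := by
  let φ : ℂ →ₗ[ℤ] ℂ := (((M : ℚ)⁻¹ • LinearMap.id : ℂ →ₗ[ℚ] ℂ)).toAddMonoidHom.toIntLinearMap
  have hφ : ∀ z, φ z = (M : ℚ)⁻¹ • z := fun z => rfl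
  have h1 : φ ((M : ℚ) • x) ∈ Submodule.map φ (Submodule.span ℤ (range b)) := Submodule.mem_map_of_mem hx
  rw [Submodule.map_span, ← Set.range_comp] at h1
  have h2 : φ ((M : ℚ) • x) = x := by
    rw [hφ, smul_smul, inv_mul_cancel₀ (Nat.cast_ne_zero.2 hM), one_smul]
  rw [h2] at h1
  exact h1

/-- Finitely many elements of a ℚ-span lie in the ℤ-span after a common integer rescaling of the family. -/
theorem exists_common_scaling {ι : Type*} (b : ι → ℂ) (Y : Finset ℂ) (hY : ∀ y ∈ Y, y ∈ Submodule.span ℚ (range b)) :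
    ∃ M : ℕ, M ≠ 0 ∧ ∀ y ∈ Y, ((M : ℚ) • y) ∈ Submodule.span ℤ (range b) := by
  classical
  induction Y using Finset.induction_on with
  | empty => exact ⟨1, one_ne_zero, fun y hy => by simp at hy⟩
  | insert a s ha ih =>
    obtain ⟨M, hM, hMs⟩ := ih fun y hy => hY y (Finset.mem_insert_of_mem hy)
    obtain ⟨Ma, hMa, hMa_mem⟩ := exists_nsmul_mem_span_int b (hY a (Finset.mem_insert_self a s))
    refine ⟨M * Ma, mul_ne_zero hM hMa, fun y hy => ?_⟩
    rcases Finset.mem_insert.mp hy with rfl | hy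
    · rw [Nat.cast_mul, ← smul_smul, Nat.cast_smul_eq_nsmul]
      exact nsmul_mem hMa_mem M
    · rw [Nat.cast_mul, mul_comm, ← smul_smul, Nat.cast_smul_eq_nsmul]
      exact nsmul_mem (hMs y hy) Ma

/-- The ℚ-span of a family lies in the field it generates together with its exponentials. -/
theorem mem_adjoin_of_mem_span {ι : Type*} (b : ι → ℂ) {x : ℂ} (hx : x ∈ Submodule.span ℚ (range b)) :
    x ∈ IntermediateField.adjoin ℚ (range b ∪ range (cexp ∘ b)) := by
  have h : Submodule.span ℚ (range b) ≤
      Subalgebra.toSubmodule (IntermediateField.adjoin ℚ (range b ∪ range (cexp ∘ b))).toSubalgebra :=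
    Submodule.span_le.2 (by
      rintro _ ⟨j, rfl⟩
      exact IntermediateField.subset_adjoin ℚ _ (Or.inl ⟨j, rfl⟩))
  exact h hx

/-! ### 1.2 Relative depth `≤ 1` in three kinds -/

/-- A field generated by at most one element has transcendence degree `≤ 1` (stated for a subsingleton SET so that the
expected type fixes the generator; the plain singleton form is `RoyThesisNegative.trdeg_adjoin_simple_le_one` on another cone). -/
theorem trdeg_adjoin_le_one_of_subsingleton {S : Set ℂ} (hS : S.Subsingleton) :
    Algebra.trdeg ℚ ↥(IntermediateField.adjoin ℚ S) ≤ 1 := by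
  rcases S.eq_empty_or_nonempty with h | ⟨v, hv⟩
  · have hsub : S ⊆ Set.range ![(0 : ℂ)] := by rw [h]; exact Set.empty_subset _
    have h' := (OneMotiveToric.trdeg_mono (IntermediateField.adjoin.mono ℚ _ _ hsub)).trans
      (trdeg_adjoin_range_le (F := ℚ) ![(0 : ℂ)])
    exact_mod_cast h'
  · have hsub : S ⊆ Set.range ![v] := fun z hz => ⟨0, by simp [hS hz hv]⟩
    have h' := (OneMotiveToric.trdeg_mono (IntermediateField.adjoin.mono ℚ _ _ hsub)).trans
      (trdeg_adjoin_range_le (F := ℚ) ![v])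
    exact_mod_cast h'

/-- Relative depth `≤ 1` of `(g, e^g)` over a field containing `g`. -/
theorem trdeg_adjoin_pair_le_of_mem {S : Set ℂ} {g : ℂ} (hg : g ∈ IntermediateField.adjoin ℚ S) :
    Algebra.trdeg ℚ ↥(IntermediateField.adjoin ℚ (S ∪ ({g, cexp g} : Set ℂ))) ≤
      Algebra.trdeg ℚ ↥(IntermediateField.adjoin ℚ S) + 1 := by
  have hle : IntermediateField.adjoin ℚ (S ∪ ({g, cexp g} : Set ℂ)) ≤ IntermediateField.adjoin ℚ (S ∪ {cexp g}) := by
    rw [IntermediateField.adjoin_le_iff]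
    rintro a (ha | rfl | rfl)
    · exact IntermediateField.subset_adjoin ℚ _ (Or.inl ha)
    · exact IntermediateField.adjoin.mono ℚ _ _ Set.subset_union_left hg
    · exact IntermediateField.subset_adjoin ℚ _ (Or.inr rfl)
  calc Algebra.trdeg ℚ ↥(IntermediateField.adjoin ℚ (S ∪ ({g, cexp g} : Set ℂ)))
      ≤ Algebra.trdeg ℚ ↥(IntermediateField.adjoin ℚ (S ∪ {cexp g})) := OneMotiveToric.trdeg_mono hle
    _ ≤ Algebra.trdeg ℚ ↥(IntermediateField.adjoin ℚ S) + Algebra.trdeg ℚ ↥(IntermediateField.adjoin ℚ ({cexp g} : Set ℂ)) :=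
        trdeg_adjoin_union_le _ _
    _ ≤ Algebra.trdeg ℚ ↥(IntermediateField.adjoin ℚ S) + 1 := add_le_add le_rfl (trdeg_adjoin_le_one_of_subsingleton Set.subsingleton_singleton)

/-- Relative depth `≤ 1` of `(g, e^g)` over a field containing `e^g`. -/
theorem trdeg_adjoin_pair_le_of_exp_mem {S : Set ℂ} {g : ℂ} (hg : cexp g ∈ IntermediateField.adjoin ℚ S) :
    Algebra.trdeg ℚ ↥(IntermediateField.adjoin ℚ (S ∪ ({g, cexp g} : Set ℂ))) ≤
      Algebra.trdeg ℚ ↥(IntermediateField.adjoin ℚ S) + 1 := by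
  have hle : IntermediateField.adjoin ℚ (S ∪ ({g, cexp g} : Set ℂ)) ≤ IntermediateField.adjoin ℚ (S ∪ {g}) := by
    rw [IntermediateField.adjoin_le_iff]
    rintro a (ha | rfl | rfl)
    · exact IntermediateField.subset_adjoin ℚ _ (Or.inl ha)
    · exact IntermediateField.subset_adjoin ℚ _ (Or.inr rfl)
    · exact IntermediateField.adjoin.mono ℚ _ _ Set.subset_union_left hg
  calc Algebra.trdeg ℚ ↥(IntermediateField.adjoin ℚ (S ∪ ({g, cexp g} : Set ℂ)))
      ≤ Algebra.trdeg ℚ ↥(IntermediateField.adjoin ℚ (S ∪ {g})) := OneMotiveToric.trdeg_mono hle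
    _ ≤ Algebra.trdeg ℚ ↥(IntermediateField.adjoin ℚ S) + Algebra.trdeg ℚ ↥(IntermediateField.adjoin ℚ ({g} : Set ℂ)) :=
        trdeg_adjoin_union_le _ _
    _ ≤ Algebra.trdeg ℚ ↥(IntermediateField.adjoin ℚ S) + 1 := add_le_add le_rfl (trdeg_adjoin_le_one_of_subsingleton Set.subsingleton_singleton)

/-- Relative depth `≤ 1` of the Baker period `β·l` (`β` algebraic, `e^l` algebraic) over any field. -/
theorem trdeg_adjoin_pair_le_of_baker {S : Set ℂ} {β l : ℂ} (hβ : IsAlgebraic ℚ β)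
    (hl : l ∈ IntermediateField.adjoin ℚ S) :
    Algebra.trdeg ℚ ↥(IntermediateField.adjoin ℚ (S ∪ ({β * l, cexp (β * l)} : Set ℂ))) ≤
      Algebra.trdeg ℚ ↥(IntermediateField.adjoin ℚ S) + 1 := by
  have hmem : β * l ∈ IntermediateField.adjoin ℚ (S ∪ {β}) :=
    mul_mem (IntermediateField.subset_adjoin ℚ _ (Or.inr rfl))
      (IntermediateField.adjoin.mono ℚ _ _ Set.subset_union_left hl)
  have hβS : Algebra.trdeg ℚ ↥(IntermediateField.adjoin ℚ (S ∪ {β})) = Algebra.trdeg ℚ ↥(IntermediateField.adjoin ℚ S) :=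
    Literature.Barriers.Schanuel.trdeg_adjoin_union_eq_of_isAlgebraic (K := ℚ) S {β} fun x hx => by
      rwa [Set.mem_singleton_iff.mp hx]
  calc Algebra.trdeg ℚ ↥(IntermediateField.adjoin ℚ (S ∪ ({β * l, cexp (β * l)} : Set ℂ)))
      ≤ Algebra.trdeg ℚ ↥(IntermediateField.adjoin ℚ ((S ∪ {β}) ∪ ({β * l, cexp (β * l)} : Set ℂ))) :=
        OneMotiveToric.trdeg_mono (IntermediateField.adjoin.mono ℚ _ _ (Set.union_subset_union_left _ Set.subset_union_left))
    _ ≤ Algebra.trdeg ℚ ↥(IntermediateField.adjoin ℚ (S ∪ {β})) + 1 := trdeg_adjoin_pair_le_of_mem hmem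
    _ = Algebra.trdeg ℚ ↥(IntermediateField.adjoin ℚ S) + 1 := by rw [hβS]

/-- ALGEBRAIC NUMBERS ARE DEPTH ONE … -/
theorem depthOne_of_isAlgebraic {u : ℂ} (hu : IsAlgebraic ℚ u) :
    Algebra.trdeg ℚ ↥(IntermediateField.adjoin ℚ ({u, cexp u} : Set ℂ)) ≤ 1 := by
  have hsub : ({u, cexp u} : Set ℂ) ⊆ {cexp u} ∪ {u} := by
    intro z hz
    rcases hz with rfl | hz
    · exact Or.inr rfl
    · exact Or.inl hz
  have hT : ∀ x ∈ ({u} : Set ℂ), IsAlgebraic ℚ x := fun x hx => by rwa [Set.mem_singleton_iff.mp hx]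
  exact (OneMotiveToric.trdeg_mono (IntermediateField.adjoin.mono ℚ _ _ hsub)).trans
    ((Literature.Barriers.Schanuel.trdeg_adjoin_union_eq_of_isAlgebraic (K := ℚ) ({cexp u} : Set ℂ) {u} hT).le.trans
      (trdeg_adjoin_le_one_of_subsingleton Set.subsingleton_singleton))

/-- … and so are LOGARITHMS OF ALGEBRAIC NUMBERS. -/
theorem depthOne_of_isAlgebraic_exp {u : ℂ} (hu : IsAlgebraic ℚ (cexp u)) :
    Algebra.trdeg ℚ ↥(IntermediateField.adjoin ℚ ({u, cexp u} : Set ℂ)) ≤ 1 := by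
  have hsub : ({u, cexp u} : Set ℂ) ⊆ {u} ∪ {cexp u} := by
    intro z hz
    rcases hz with rfl | hz
    · exact Or.inl rfl
    · exact Or.inr hz
  have hT : ∀ x ∈ ({cexp u} : Set ℂ), IsAlgebraic ℚ x := fun x hx => by rwa [Set.mem_singleton_iff.mp hx]
  exact (OneMotiveToric.trdeg_mono (IntermediateField.adjoin.mono ℚ _ _ hsub)).trans
    ((Literature.Barriers.Schanuel.trdeg_adjoin_union_eq_of_isAlgebraic (K := ℚ) ({u} : Set ℂ) {cexp u} hT).le.trans
      (trdeg_adjoin_le_one_of_subsingleton Set.subsingleton_singleton))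


end Summit.Schanuel.Schanuel.Theorems.RootDecomp1HCurveHull
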